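import Literature.MathematicalPhysics.QuantumFieldTheory.Balaban1983to89.Node00.OpsYDeltaA

/-!
# `Balaban1983to89.Node00.OpsYGauge` — T. Bałaban, *Propagators for lattice gauge theories in a background field*, Commun. Math. Phys. **99**
# (1985) 389–434 [Balaban1985BackgroundPropagators], (3.28)–(3.34) pp. 395–396: THE GAUGE COVARIANCE OF NODE 00's OPERATOR LAYER — the action
# `U ↦ U^u` on backgrounds, the TAXICAB TRANSPORTERS TRANSFORM AS CONTOUR VARIABLES `U^u(Γ_{y,x}) = u(y)U(Γ_{y,x})u(x)⁻¹`, and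
# `L(U^u)R(u) = R(u)L(U)` PROVED for every letter of def-Y's v2 family ∕ of the letters of record `lettersYOfRecord`: `D_U`, `D*_U`, the curl and
# co-curl, `Q(U)`, `Q*(U)`, `Q′(U)`, `Q′*(U)`, the Hessian `Δ(U) = D*_U𝒦_UD_U + Δ′₂(U)` of (3.10), `Δ_U` (3.23), `Δ′_a(U)` (3.24), `G′(U)`, `R(U)`
# (3.25), `C(U) = (Q′G′²Q′*)⁻¹(U)` (3.48), `Δ_a(U)` (3.26) and `G(U) = Δ_a(U)⁻¹` (3.27)

statement-level skeleton of published theorems with citation tags; proofs where landed; nothing here is a claim about the Yang–Mills mass gap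

PDF held: `paper:balaban1985-cmp99-background-propagators` (journal page = PDF page + 388); pp. 395–396 read from the held text (`lit read … --pages
7-8`, text layers `p0007.txt`, `p0008.txt`); equation numbers and pages below are the print's ((3.20)–(3.25) p. 394, (3.26)–(3.32) p. 395, (3.33)–(3.34)
p. 396).  [4] = [Balaban1984PropagatorsII] (the `U = 1` objects, typed as p21 ∕ T8 ∕ r03 — see `Node00.OpsYDeltaA`).

THE PRINT (p. 395–396, verbatim up to OCR repair).
* p. 395: *«All the operators introduced above depend on a gauge field configuration U. Let us discuss how these operators transform under gauge
  transformations of the configuration U. … if we make the transformations U → U^u, U′ → R(u)U′, (3.28) where U^u(x, x′) = u(x)U(x, x′)u⁻¹(x′),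
  (R(u)U′)(x, x′) = R(u(x))U′(x, x′), then 𝒜^η(R(u)U′U^u) = 𝒜^η((U′U)^u) = 𝒜^η(U′U). (3.29) Of course R(u(x)) exp iηA(x, x′) = exp iηR(u(x))A(x, x′)
  and R(u)A is linear in A, hence expanding both sides of the above equality in A we get a sequence of equalities between homogeneous polynomials of
  the same order. Taking the polynomials of first and second order we get ⟨R(u)A, J^u⟩ = ⟨A, J⟩, ⟨R(u)A, Δ(U^u)R(u)A⟩ = ⟨A, Δ(U)A⟩, (3.30) or
  J^u = R(u)J, Δ(U^u) = R(u)Δ(U)R(u⁻¹). We have a similar situation for the other operators. For the covariant Laplace operator (3.23) we have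
  ⟨R(u)λ, Δ_{U^u}R(u)λ⟩ = ⟨λ, Δ_Uλ⟩, hence Δ_{U^u} = R(u)Δ_UR(u⁻¹). (3.31) The matrices in the definitions (3.19) transform as follows
  R(U^u(Γ_{y,x})) = R(u(y))R(U(Γ_{y,x}))R(u⁻¹(x)), hence (Q′_j(U^u)R(u)λ)(y) = R(u(y))(Q′_j(U)λ)(y), (3.32)»*
* p. 396: *«The equalities (3.31), (3.32) imply further G′(U^u) = R(u)G′(U)R(u⁻¹), R(U^u) = R(u)R(U)R(u⁻¹). (3.33) Finally inspecting the definitions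
  of the averaging operators Q_j(U) for gauge fields we can see that the equalities (3.32) hold again. This implies the transformation laws for the
  operators Δ_a and G: Δ_a(U^u) = R(u)Δ_a(U)R(u⁻¹), G(U^u) = R(u)G(U)R(u⁻¹). (3.34)»*

WHY THIS FILE (cell context).  `Node00.OpsYDeltaA` (p484082) completed def-Y's letter family of record (`covLettersY_v2`, `lettersYOfRecord`,
`opsYOfRecord`) and declared in its scope note (M5) that the gauge covariance (3.28)–(3.34) of the ASSEMBLED letters was not typed — only its engine
`trLiftY_gauge` (a transporter table transforming as `T′(y, x) = u_Y(y)T(y, x)u_X(x)⁻¹` on its support lifts to an operator intertwining `R(u_X)` and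
`R(u_Y)`).  This file discharges that note for every letter.  Print derives (3.30)–(3.34) from the gauge invariance (3.29) of the action and of the
quadratic forms; here they are OPERATOR IDENTITIES proved directly from the transformation laws of the layer's transporter tables — which is also the
kernel check of those tables' orientation conventions (`gradT`, `curlT`, `edgeParY`, `holY`, `qT`, `qpT`, `avgTrY`) and of the telescoping of the
taxicab contours of `Node00.OpsYTransport` (`parTaxiV_gaugeV`: the record's declared-P2 contours obey print's contour law of (3.32) exactly as the
straight ones do).  OTHER-CARRIER ANALOGUES IN THE TREE (cited, not importable here, nothing of theirs restated on their carriers): the pub-balaban NE9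
chain typed (3.28)–(3.34) for ITS operators on the `B9SectCLatticeCarrier` ∕ `BondL2K` ∕ `TSite d (fineP L m)` carriers — `B9Eq328GaugeAction`,
`B9Eq330HessianCovariance` (via the invariance of the curvature FORM, with a trace-invariance hypothesis `hτ`), `B9Eq331LatticeCov`,
`B9Eq332AvgCovariance` ∕ `B9Eq332FieldAvgCovariance` ∕ `B9Eq332QprimeTowerGaugeCovariance`, `B9Eq333ProjectionCovariance` ∕ `B9Eq333Cov` (for the
orthogonal projection, with a unitarity hypothesis `hAd`), `B9Eq334LaplaceACovariance` ∕ `B9Eq334LaplaceAkCovariance` ∕ `B9Eq334GreenkCovariance`;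
NODE 00's letters live on the [B6]-census carriers `SiteY ∕ FBondY ∕ PlaqY ∕ BlkY ∕ IBondY` of `Node00.CarriersB6K` with the explicit formula (3.25) for
`R(U)` and `Ring.inverse`s for `G′, (Q′G′²Q′*)⁻¹, G`, so the identities hold for EVERY `𝔸ˣ`-valued gauge function, with no unitarity or smallness
hypothesis, and are the ones the N06 knit at `opsYOfRecord` can consume.

WHAT IS PROVED (all `theorem`s, no `sorry`).
* §1–§2 the INTERTWINING ALGEBRA `Intw σ τ L L′ :⇔ L′ ∘ σ = τ ∘ L` (closed under `∘, +, −, •, Σ, ite, LinearMap.pi`, and under `Ring.inverse` when `σ`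
  is a unit: `Intw.ringInverse`), the carrier transformation `conjY γ := (F ↦ R(γ ·)F ·)` (a unit: `isUnit_conjY`), and the engines
  `intw_trLiftY` (= `trLiftY_gauge`) ∕ `intw_trLiftY_transpose` (adjoint letters with inverted transporters) ∕ `intw_liftMatY_diagonal` ∕ `intw_commY`.
* §3 on the unit torus `Site P 0`: `gaugeV g U μ x = g x · U μ x · g(x + e_μ)⁻¹` ((3.28); `gaugeV_one`, `gaugeV_mul` — a left action), and BY
  INDUCTION ALONG THE CONTOUR `parFwdV_gaugeV`, `parBwdV_gaugeV`, `taxiLegV_gaugeV`, `taxiRun_gaugeV`, ★ `parTaxiV_gaugeV :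
  parTaxiV (gaugeV g U) x x′ = g x * parTaxiV U x x′ * (g x′)⁻¹`.
* §4 at an index `i`: `gaugeY`, the gauge function read on the five carriers (`gSiteY` box chart, `gBondY ∕ gPlaqY` at the source ∕ corner, `gBlkY` at
  the block corner, `gIBondY` at the embedded source of the index bond), the table laws `gradT_gaugeY`, `curlT_gaugeY` (on the stencils, via r03's
  `dE_ne_zero_cases ∕ dcE_ne_zero_cases`), `IsGaugeLawB ∕ IsGaugeLawS` with ★ `parBY_isGaugeLawB`, `parSY_isGaugeLawS`, and `qT_gaugeY ∕ qpT_gaugeY`.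
* §5 ★ `gradY_cov`, `divY_cov`, `curlY_cov`, `coCurlY_cov`, `QY_cov`, `QsY_cov`, `QpY_cov`, `QpsY_cov`, `aY_cov` (`aK_eq_diagonal`); the plaquette
  sector `holY_gaugeY : holY (U^u) p = u(x)·holY U p·u(x)⁻¹`, `reHolY_gaugeY ∕ imHolY_gaugeY`, `jordanY_cov`, `edgeParY_gaugeY`, `primeEdgeY_cov`,
  ★ `curv2Y_cov` and ★★ `hessY_cov : Intw (conjY u_b) (conjY u_b) (hessY i U) (hessY i (U^u))` — (3.30).
* §6 the site sector: `boxEquiv_symm_shiftY` (the chart shift is the torus shift), `cdS_gaugeY ∕ cdsS_gaugeY`, ★ `lapSL_cov` (3.31), `avgTrY_gaugeY`,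
  `deltaPrimeAY_cov`, ★★ `GpY_cov` (3.33).
* §7 for lawful `parS ∕ parB` and a covariant `G′` (`IsCovSiteOpY`; `GpY_isCovSiteOpY`): `XY_cov`, `XinvY_cov`, ★ `RY_cov` (3.33), ★ `CY_cov`,
  ★★ `deltaAY_cov` and ★★★ `GAY_cov` (3.34).
* §8 the record: `covLettersY_v2_parS_law ∕ _parB_law ∕ _Gp_cov ∕ _C_cov ∕ _GA_cov` and ★★★ `lettersYOfRecord_cov` — for every member `x` of
  Stage 3′(Y), every gauge function and every background, the letters `GA, C, Gp` of `lettersYOfRecord N θ M⋆ x` intertwine `R(u)` on their carriers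
  and its transporters obey the contour law.

MODEL ∕ DECLARED READINGS.  (M1) as in `Node00.OpsYDeltaA`: fibre any complete normed ℂ-algebra `𝔸`, `U` and the gauge functions `u` valued in `𝔸ˣ`
(print: in the gauge group `G ⊆ 𝔸ˣ`; the subgroup plays no role in the algebra), `R(V)X = VXV⁻¹` (`B9Eq39Adjoint.R`).  (M2) «`L(U^u)R(u) = R(u)L(U)`»
is typed as `Intw (conjY u_X) (conjY u_Y) (L U) (L U^u)` with `u_X, u_Y` the gauge function read on the source ∕ target carrier (M1 of the dictionary:
a bond ∕ plaquette ∕ block ∕ coarse-bond function is acted on at its source ∕ corner ∕ block corner ∕ embedded source — print's «(R(u)U′)(x, x′) =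
R(u(x))U′(x, x′)»); since `conjY u` is invertible this is print's `L(U^u) = R(u)L(U)R(u⁻¹)`.  (M3) INVERSES are `Ring.inverse`s (M3 of
`Node00.OpsYDeltaA`): where `Δ′_a(U)`, `Q′G′²Q′*(U)`, `Δ_a(U)` are units the genuine inverses are conjugate, elsewhere both sides of the identity are
the conjugates of `0` (`Intw.ringInverse`), so (3.33)–(3.34) hold unconditionally in this reading.  (M4) NOT HERE: (3.29) itself (the action `𝒜^η` and
its expansion (3.6)–(3.7), `J^u = R(u)J`) — the layer has no action functional; any estimate; the unitarity of `R(u)` on the fibre.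
HONEST SCOPE.  Exact finite-dimensional lattice algebra: the transformation laws (3.28), (3.30)–(3.34) of the printed operators as realised by def-Y's
letters on NODE 00's carriers, proved for all backgrounds and all invertible gauge functions; no inequality of the paper; NOT summit progress (route
BalabanUVNodes: N06 obligations are hypotheses of the knit).  Possible consumers: the N06 knit (transfer of letter estimates along gauge orbits, cf.
the NE9 chain's `hpos_gaugeU_iff`), n06-c's frame rows; nothing of n06-f ∕ g ∕ h's `U = 1` rows is restated.  Two folklore lattice lemmas
(`(x − e_μ) + e_μ = x`, commuting shifts) are PRIVATE restatements — their public copies (`HiggsHodgeIdentity.shift_comm`,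
`B3Eq14CutoffExists.shift_shift_comm`) lie outside this file's import closure.  Filed by the pub-ymgap def-Y owner lineage (`pub-ymgap-node00-def-Y`,
gen 2); a NEW sibling file importing only `Node00.OpsYDeltaA`; nothing landed is modified.
Net new unproved facts: 0.
-/

noncomputable section

namespace Literature.MathematicalPhysics.QuantumFieldTheory.Balaban1983to89.Node00

open B6KLevelCensusIndexV1 (KIdx)
open B6GlobalChartV1 (PV boxEquiv boxEquiv_apply toBox)
open B6ScalarChartV1 (toBox_shift)
open B6SectAOperatorsV1 (dE dcE aE aE_apply)
open B6Ineq2133TwoScaleV1 (onFun onFun_apply)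
open B6AgreeLapV1Chart (dE_ne_zero_cases dcE_ne_zero_cases)
open B15DeterminingSets (embIter)
open B9Eq39Adjoint (R R_def R_one R_add R_sub R_smul R_mul R_mul_R R_zero R_inv_R)
open B9BackgroundsKLevelV1 (CfgV1)
open B9PinMembersKLevelV1 (MemberY)
open scoped Matrix

variable {d ℓ : ℕ} {hd : 1 ≤ d + 1} {hL : Odd (ℓ + 1) ∧ 1 < ℓ + 1} {b₀ b₁ : ℝ} {Mstar : ℕ}
variable {𝔸 : Type} [NormedRing 𝔸] [NormedAlgebra ℂ 𝔸] [CompleteSpace 𝔸]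

/-! ## §1 Intertwining algebra: `L′ ∘ σ = τ ∘ L` is closed under the operations the letters are built from -/

section Intertwine

variable {M N O : Type} [AddCommGroup M] [Module ℂ M] [AddCommGroup N] [Module ℂ N] [AddCommGroup O] [Module ℂ O]

/-- `L′` INTERTWINES the pair of transformations `(σ, τ)` with `L`: `L′ ∘ σ = τ ∘ L` (for the letters: `L′ = L(U^u)`, `σ, τ = R(u)` on the
source and target carriers — print's «R(u)A is linear … we have a similar situation for the other operators»). [cite: Balaban1985BackgroundPropagators, (3.28)–(3.34) pp.395–396] -/
def Intw (σ : M →ₗ[ℂ] M) (τ : N →ₗ[ℂ] N) (L L' : M →ₗ[ℂ] N) : Prop := L' ∘ₗ σ = τ ∘ₗ L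

variable {σ : M →ₗ[ℂ] M} {τ : N →ₗ[ℂ] N} {υ : O →ₗ[ℂ] O}

/-- the relation, applied. [cite: Balaban1985BackgroundPropagators, (3.30)–(3.34) pp.395–396, bookkeeping] -/
theorem Intw.apply {L L' : M →ₗ[ℂ] N} (h : Intw σ τ L L') (m : M) : L' (σ m) = τ (L m) := LinearMap.congr_fun h m

/-- composition. [cite: Balaban1985BackgroundPropagators, (3.30)–(3.34) pp.395–396, bookkeeping] -/
theorem Intw.comp {K K' : N →ₗ[ℂ] O} {L L' : M →ₗ[ℂ] N} (hK : Intw τ υ K K') (hL : Intw σ τ L L') : Intw σ υ (K ∘ₗ L) (K' ∘ₗ L') := by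
  unfold Intw at *
  rw [LinearMap.comp_assoc, hL, ← LinearMap.comp_assoc, hK, LinearMap.comp_assoc]

/-- sums. [cite: Balaban1985BackgroundPropagators, (3.30)–(3.34) pp.395–396, bookkeeping] -/
theorem Intw.add {L₁ L₁' L₂ L₂' : M →ₗ[ℂ] N} (h₁ : Intw σ τ L₁ L₁') (h₂ : Intw σ τ L₂ L₂') : Intw σ τ (L₁ + L₂) (L₁' + L₂') := by
  unfold Intw at *
  rw [LinearMap.add_comp, LinearMap.comp_add, h₁, h₂]

/-- differences. [cite: Balaban1985BackgroundPropagators, (3.30)–(3.34) pp.395–396, bookkeeping] -/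
theorem Intw.sub {L₁ L₁' L₂ L₂' : M →ₗ[ℂ] N} (h₁ : Intw σ τ L₁ L₁') (h₂ : Intw σ τ L₂ L₂') : Intw σ τ (L₁ - L₂) (L₁' - L₂') := by
  unfold Intw at *
  rw [LinearMap.sub_comp, LinearMap.comp_sub, h₁, h₂]

/-- scalar multiples. [cite: Balaban1985BackgroundPropagators, (3.30)–(3.34) pp.395–396, bookkeeping] -/
theorem Intw.smul {L L' : M →ₗ[ℂ] N} (c : ℂ) (h : Intw σ τ L L') : Intw σ τ (c • L) (c • L') := by
  unfold Intw at *
  rw [LinearMap.smul_comp, LinearMap.comp_smul, h]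

/-- zero. [cite: Balaban1985BackgroundPropagators, (3.30)–(3.34) pp.395–396, bookkeeping] -/
theorem Intw.zero : Intw σ τ (0 : M →ₗ[ℂ] N) 0 := by
  unfold Intw
  rw [LinearMap.zero_comp, LinearMap.comp_zero]

/-- the identity. [cite: Balaban1985BackgroundPropagators, (3.30)–(3.34) pp.395–396, bookkeeping] -/
theorem Intw.id : Intw σ σ LinearMap.id LinearMap.id := by
  unfold Intw
  rw [LinearMap.id_comp, LinearMap.comp_id]

/-- finite sums. [cite: Balaban1985BackgroundPropagators, (3.30)–(3.34) pp.395–396, bookkeeping] -/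
theorem Intw.sum {ι : Type} (s : Finset ι) {L L' : ι → M →ₗ[ℂ] N} (h : ∀ k ∈ s, Intw σ τ (L k) (L' k)) :
    Intw σ τ (∑ k ∈ s, L k) (∑ k ∈ s, L' k) := by
  classical
  induction s using Finset.induction_on with
  | empty => rw [Finset.sum_empty, Finset.sum_empty]; exact Intw.zero
  | insert a s ha ih =>
    rw [Finset.sum_insert ha, Finset.sum_insert ha]
    exact (h a (Finset.mem_insert_self a s)).add (ih fun k hk => h k (Finset.mem_insert_of_mem hk))

/-- case splits (same condition on both sides). [cite: Balaban1985BackgroundPropagators, (3.30)–(3.34) pp.395–396, bookkeeping] -/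
theorem Intw.ite (c : Prop) [Decidable c] {L L' : M →ₗ[ℂ] N} (h : c → Intw σ τ L L') :
    Intw σ τ (if c then L else 0) (if c then L' else 0) := by
  split_ifs with hc
  · exact h hc
  · exact Intw.zero

/-- ★ INVERSES: if `σ` is invertible and `L′σ = σL` then `Ring.inverse L′ ∘ σ = σ ∘ Ring.inverse L` — both when `L` is invertible (conjugate
inverses) and when it is not (then neither is `L′`, and both sides vanish). [cite: Balaban1985BackgroundPropagators, (3.33)–(3.34) p.396 («G′(U^u) = R(u)G′(U)R(u⁻¹) … G(U^u) = R(u)G(U)R(u⁻¹)»)] -/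
theorem ringInverse_mul_of_mul_eq {Rg : Type} [MonoidWithZero Rg] {γ a a' : Rg} (hγ : IsUnit γ) (h : a' * γ = γ * a) :
    Ring.inverse a' * γ = γ * Ring.inverse a := by
  obtain ⟨u, rfl⟩ := hγ
  have ha' : a' = ↑u * a * ↑u⁻¹ := by rw [← h, mul_assoc, Units.mul_inv, mul_one]
  by_cases ha : IsUnit a
  · obtain ⟨v, rfl⟩ := ha
    have hv : a' = ↑(u * v * u⁻¹) := by rw [ha', Units.val_mul, Units.val_mul]
    rw [hv, Ring.inverse_unit, Ring.inverse_unit, mul_inv_rev, mul_inv_rev, inv_inv, Units.val_mul, Units.val_mul, mul_assoc,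
      Units.inv_mul_cancel_right]
  · have ha'' : ¬ IsUnit a' := by
      intro hu
      apply ha
      have : a = ↑u⁻¹ * a' * ↑u := by rw [ha', ← mul_assoc, ← mul_assoc, Units.inv_mul, one_mul, mul_assoc, Units.inv_mul, mul_one]
      rw [this]
      exact ((Units.isUnit u⁻¹).mul hu).mul (Units.isUnit u)
    rw [Ring.inverse_non_unit _ ha, Ring.inverse_non_unit _ ha'', zero_mul, mul_zero]

/-- ★ `Ring.inverse` preserves intertwining with an invertible `σ`. [cite: Balaban1985BackgroundPropagators, (3.33)–(3.34) p.396] -/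
theorem Intw.ringInverse {L L' : Module.End ℂ M} (hσ : IsUnit σ) (h : Intw σ σ L L') : Intw σ σ (Ring.inverse L) (Ring.inverse L') := by
  unfold Intw at *
  rw [← Module.End.mul_eq_comp, ← Module.End.mul_eq_comp] at h ⊢
  exact ringInverse_mul_of_mul_eq hσ h

end Intertwine

/-! ## §2 `R(u)` on a carrier of `𝔸`-valued functions; the engine restated -/

section Conj

variable {X Y Z : Type} [Fintype X] [Fintype Y] [Fintype Z]

/-- **`R(u)` ON A CARRIER** (3.28): `(R(u)Λ)(x) = R(u(x))Λ(x) = u(x)Λ(x)u(x)⁻¹`, pointwise conjugation by a unit-valued function.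
[cite: Balaban1985BackgroundPropagators, (3.28) p.395 («(R(u)U′)(x, x′) = R(u(x))U′(x, x′)»)] -/
def conjY (γ : X → 𝔸ˣ) : (X → 𝔸) →ₗ[ℂ] (X → 𝔸) where
  toFun Λ := fun x => R (γ x) (Λ x)
  map_add' _ _ := funext fun _ => R_add _ _ _
  map_smul' _ _ := funext fun _ => R_smul _ _ _

omit [Fintype X] [CompleteSpace 𝔸] in
/-- `R(u)`, evaluated. [cite: Balaban1985BackgroundPropagators, (3.28) p.395, bookkeeping] -/
theorem conjY_apply (γ : X → 𝔸ˣ) (Λ : X → 𝔸) (x : X) : conjY γ Λ x = R (γ x) (Λ x) := rfl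

omit [Fintype X] [CompleteSpace 𝔸] in
/-- `R(1) = 1`. [cite: Balaban1985BackgroundPropagators, (3.28) p.395, bookkeeping] -/
theorem conjY_one : conjY (1 : X → 𝔸ˣ) = LinearMap.id :=
  LinearMap.ext fun _ => funext fun _ => R_one _

omit [Fintype X] [CompleteSpace 𝔸] in
/-- `R(uv) = R(u)R(v)`. [cite: Balaban1985BackgroundPropagators, (3.28) p.395, bookkeeping] -/
theorem conjY_mul (γ γ' : X → 𝔸ˣ) : conjY (γ * γ') = conjY γ ∘ₗ conjY γ' :=
  LinearMap.ext fun _ => funext fun _ => B9Eq39Adjoint.R_mul _ _ _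

omit [Fintype X] [CompleteSpace 𝔸] in
/-- `R(u)` is invertible, `R(u)⁻¹ = R(u⁻¹)`. [cite: Balaban1985BackgroundPropagators, (3.31) p.395 («R(u⁻¹)»), bookkeeping] -/
theorem isUnit_conjY (γ : X → 𝔸ˣ) : IsUnit (conjY γ : Module.End ℂ (X → 𝔸)) := by
  refine ⟨⟨conjY γ, conjY γ⁻¹, ?_, ?_⟩, rfl⟩
  · rw [Module.End.mul_eq_comp, ← conjY_mul, mul_inv_cancel, conjY_one]; rfl
  · rw [Module.End.mul_eq_comp, ← conjY_mul, inv_mul_cancel, conjY_one]; rfl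

omit [Fintype Y] [CompleteSpace 𝔸] in
/-- ★ THE ENGINE, as an intertwining relation: a transporter law `T′(y, x) = u_Y(y)T(y, x)u_X(x)⁻¹` on the support of the kernel gives
`M♯_{T′} ∘ R(u_X) = R(u_Y) ∘ M♯_T` (`trLiftY_gauge`). [cite: Balaban1985BackgroundPropagators, (3.28) p.395, (3.32) p.395 («R(U^u(Γ_{y,x})) = R(u(y))R(U(Γ_{y,x}))R(u⁻¹(x))»)] -/
theorem intw_trLiftY (M : Matrix Y X ℝ) (T T' : Y → X → 𝔸ˣ) (gX : X → 𝔸ˣ) (gY : Y → 𝔸ˣ)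
    (hT : ∀ y x, M y x ≠ 0 → T' y x = gY y * T y x * (gX x)⁻¹) : Intw (conjY gX) (conjY gY) (trLiftY M T) (trLiftY M T') :=
  LinearMap.ext fun Λ => funext fun y => trLiftY_gauge M T T' gX gY hT Λ y

omit [Fintype X] [CompleteSpace 𝔸] in
/-- the engine for an ADJOINT letter (transposed kernel, inverted transporters): the same law gives `(Mᵀ)♯_{T′⁻¹} ∘ R(u_Y) = R(u_X) ∘ (Mᵀ)♯_{T⁻¹}`.
[cite: Balaban1985BackgroundPropagators, (3.8)–(3.9) p.392, (3.30)–(3.31) p.395] -/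
theorem intw_trLiftY_transpose (M : Matrix Y X ℝ) (T T' : Y → X → 𝔸ˣ) (gX : X → 𝔸ˣ) (gY : Y → 𝔸ˣ)
    (hT : ∀ y x, M y x ≠ 0 → T' y x = gY y * T y x * (gX x)⁻¹) :
    Intw (conjY gY) (conjY gX) (trLiftY Mᵀ fun x y => (T y x)⁻¹) (trLiftY Mᵀ fun x y => (T' y x)⁻¹) :=
  intw_trLiftY Mᵀ _ _ gY gX fun x y hM => by
    rw [Matrix.transpose_apply] at hM
    rw [hT y x hM, mul_inv_rev, mul_inv_rev, inv_inv, mul_assoc]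

omit [CompleteSpace 𝔸] in
/-- the lift of a DIAGONAL real matrix, evaluated. [cite: Balaban1985BackgroundPropagators, (3.26) p.395 (the weight `a`), bookkeeping] -/
theorem liftMatY_diagonal_apply [DecidableEq X] (w : X → ℝ) (Λ : X → 𝔸) (x : X) :
    liftMatY 𝔸 (Matrix.diagonal w) Λ x = ((w x : ℝ) : ℂ) • Λ x := by
  rw [liftMatY_apply, Finset.sum_eq_single x]
  · rw [Matrix.diagonal_apply_eq]
  · intro x' _ hx'
    rw [Matrix.diagonal_apply_ne _ (Ne.symm hx'), Complex.ofReal_zero, zero_smul]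
  · intro h
    exact absurd (Finset.mem_univ x) h

omit [CompleteSpace 𝔸] in
/-- a diagonal real weight commutes with `R(u)`. [cite: Balaban1985BackgroundPropagators, (3.30)–(3.34) pp.395–396, bookkeeping] -/
theorem intw_liftMatY_diagonal [DecidableEq X] (w : X → ℝ) (g : X → 𝔸ˣ) :
    Intw (conjY g) (conjY g) (liftMatY 𝔸 (Matrix.diagonal w)) (liftMatY 𝔸 (Matrix.diagonal w)) := by
  refine LinearMap.ext fun Λ => funext fun x => ?_
  show liftMatY 𝔸 (Matrix.diagonal w) (conjY g Λ) x = R (g x) (liftMatY 𝔸 (Matrix.diagonal w) Λ x)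
  rw [liftMatY_diagonal_apply, liftMatY_diagonal_apply, conjY_apply, R_smul]

omit [CompleteSpace 𝔸] in
/-- p473950's square transported kernel letter IS a transported lift. [cite: Balaban1985BackgroundPropagators, (3.24) p.394, bookkeeping] -/
theorem kernelTrOpY_eq_trLiftY (K : X → X → ℝ) (T : X → X → 𝔸ˣ) : kernelTrOpY K T = trLiftY (Matrix.of K) T := rfl

omit [Fintype X] [Fintype Y] [CompleteSpace 𝔸] in
/-- `LinearMap.pi` of componentwise-intertwining functionals intertwines with `R(u_Y)`. [cite: Balaban1985BackgroundPropagators, (3.30)–(3.34) pp.395–396, bookkeeping] -/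
theorem intw_pi {M : Type} [AddCommGroup M] [Module ℂ M] {σ : M →ₗ[ℂ] M} (gY : Y → 𝔸ˣ) {f f' : Y → M →ₗ[ℂ] 𝔸}
    (h : ∀ y, Intw σ (RL (gY y)) (f y) (f' y)) : Intw σ (conjY gY) (LinearMap.pi f) (LinearMap.pi f') :=
  LinearMap.ext fun m => funext fun y => (h y).apply m

omit [Fintype X] [CompleteSpace 𝔸] in
/-- the evaluation at a point intertwines `R(u)` with `R(u(x))`. [cite: Balaban1985BackgroundPropagators, (3.28) p.395, bookkeeping] -/
theorem intw_proj (g : X → 𝔸ˣ) (x : X) : Intw (conjY g) (RL (g x)) (LinearMap.proj x : (X → 𝔸) →ₗ[ℂ] 𝔸) (LinearMap.proj x) := rfl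

omit [CompleteSpace 𝔸] in
/-- conjugations of the fibre: `R(V′)R(γ) = R(γ′)R(V)` whenever `V′γ = γ′V`. [cite: Balaban1985BackgroundPropagators, (3.28) p.395, bookkeeping] -/
theorem intw_RL {γ γ' V V' : 𝔸ˣ} (h : V' * γ = γ' * V) : Intw (RL γ) (RL γ') (RL V) (RL V') :=
  LinearMap.ext fun X => show R V' (R γ X) = R γ' (R V X) by rw [← B9Eq39Adjoint.R_mul, ← B9Eq39Adjoint.R_mul, h]

omit [CompleteSpace 𝔸] in
/-- the commutator insertion is covariant: `i[R(γ)X, R(γ)M] = R(γ) i[X, M]`. [cite: Balaban1985BackgroundPropagators, (3.10) p.392, (3.30) p.395, bookkeeping] -/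
theorem intw_commY (γ : 𝔸ˣ) (Mm : 𝔸) : Intw (RL γ) (RL γ) (commY Mm) (commY (R γ Mm)) :=
  LinearMap.ext fun X => show Complex.I • (R γ X * R γ Mm - R γ Mm * R γ X) = R γ (Complex.I • (X * Mm - Mm * X)) by
    rw [R_mul_R, R_mul_R, ← R_sub, ← R_smul]

omit [NormedAlgebra ℂ 𝔸] [CompleteSpace 𝔸] in
/-- units conjugation is `R`: `γVγ⁻¹ = R(γ)V` in `𝔸`. [cite: Balaban1985BackgroundPropagators, (3.1) p.390, bookkeeping] -/
theorem val_conj_eq_R (γ V : 𝔸ˣ) : ((γ * V * γ⁻¹ : 𝔸ˣ) : 𝔸) = R γ (V : 𝔸) := by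
  rw [R_def, Units.val_mul, Units.val_mul]

end Conj

/-! ## §3 (3.28) on the torus `Site P 0`: the gauge action `U ↦ U^u` and the transformation law of the taxicab transporters -/

section Torus

variable {P : Params} {𝔹 : Type} [Ring 𝔹]

/-- `(x − e_μ) + e_μ = x`. [folklore] -/
private theorem shift_unshift' {j : ℕ} (x : Site P j) (μ : Fin P.d) : (x.unshift μ).shift μ = x := by
  funext ν
  by_cases h : ν = μ
  · subst h; simp [Site.shift, Site.unshift]
  · simp [Site.shift, Site.unshift, Function.update_of_ne h]

/-- `(x + e_μ) + e_ν = (x + e_ν) + e_μ`. [folklore] -/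
private theorem shift_shift_comm' {j : ℕ} (x : Site P j) (μ ν : Fin P.d) : (x.shift μ).shift ν = (x.shift ν).shift μ := by
  funext κ
  simp only [Site.shift_apply]
  by_cases hν : κ = ν <;> by_cases hμ : κ = μ
  · subst hν; subst hμ; simp
  · subst hν; simp [hμ]
  · subst hμ; simp [hν]
  · simp [hμ, hν]

/-- ★ **(3.28) `U^u(x, x′) = u(x)U(x, x′)u⁻¹(x′)`** on the positively oriented bonds `⟨x, x + e_μ⟩` of the unit torus: the gauge function acts at
the two ends of the bond. [cite: Balaban1985BackgroundPropagators, (3.28) p.395] -/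
def gaugeV (g : Site P 0 → 𝔹ˣ) (U : CfgV1 P 𝔹) : CfgV1 P 𝔹 := fun μ x => g x * U μ x * (g (x.shift μ))⁻¹

/-- (3.28), unfolded. [cite: Balaban1985BackgroundPropagators, (3.28) p.395] -/
theorem gaugeV_apply (g : Site P 0 → 𝔹ˣ) (U : CfgV1 P 𝔹) (μ : Fin P.d) (x : Site P 0) :
    gaugeV g U μ x = g x * U μ x * (g (x.shift μ))⁻¹ := rfl

/-- `U^1 = U`. [cite: Balaban1985BackgroundPropagators, (3.28) p.395, bookkeeping] -/
theorem gaugeV_one (U : CfgV1 P 𝔹) : gaugeV 1 U = U := by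
  funext μ x
  simp [gaugeV]

/-- `U^{uv} = (U^v)^u` (a left action). [cite: Balaban1985BackgroundPropagators, (3.28) p.395, bookkeeping] -/
theorem gaugeV_mul (g h : Site P 0 → 𝔹ˣ) (U : CfgV1 P 𝔹) : gaugeV (g * h) U = gaugeV g (gaugeV h U) := by
  funext μ x
  simp only [gaugeV, Pi.mul_apply, mul_inv_rev, mul_assoc]

/-- the forward straight contour: `U^u(Γ) = u(x)U(Γ)u(x + n e_μ)⁻¹`. [cite: Balaban1985BackgroundPropagators, (3.28) p.395, (3.40) p.397] -/
theorem parFwdV_gaugeV (g : Site P 0 → 𝔹ˣ) (U : CfgV1 P 𝔹) (μ : Fin P.d) :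
    ∀ (n : ℕ) (x : Site P 0), parFwdV (gaugeV g U) μ n x = g x * parFwdV U μ n x * (g ((fun y : Site P 0 => y.shift μ)^[n] x))⁻¹
  | 0, x => by simp
  | n + 1, x => by
    rw [parFwdV_succ, parFwdV_succ, parFwdV_gaugeV g U μ n (x.shift μ), Function.iterate_succ_apply, gaugeV_apply]
    simp only [mul_assoc, inv_mul_cancel_left]

/-- the backward straight contour: `U^u(Γ) = u(x)U(Γ)u(x − n e_μ)⁻¹`. [cite: Balaban1985BackgroundPropagators, (3.28) p.395, (3.40) p.397] -/
theorem parBwdV_gaugeV (g : Site P 0 → 𝔹ˣ) (U : CfgV1 P 𝔹) (μ : Fin P.d) :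
    ∀ (n : ℕ) (x : Site P 0), parBwdV (gaugeV g U) μ n x = g x * parBwdV U μ n x * (g ((fun y : Site P 0 => y.unshift μ)^[n] x))⁻¹
  | 0, x => by simp
  | n + 1, x => by
    rw [parBwdV_succ, parBwdV_succ, parBwdV_gaugeV g U μ n (x.unshift μ), Function.iterate_succ_apply, gaugeV_apply, shift_unshift',
      mul_inv_rev, mul_inv_rev, inv_inv]
    simp only [mul_assoc, inv_mul_cancel_left]

/-- one taxicab leg transports covariantly (the endpoint does not depend on `U`). [cite: Balaban1985BackgroundPropagators, (3.28) p.395, (3.40) p.397] -/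
theorem taxiLegV_gaugeV (g : Site P 0 → 𝔹ˣ) (U : CfgV1 P 𝔹) (x' : Site P 0) (μ : Fin P.d) (x : Site P 0) (s : Site P 0 × 𝔹ˣ) :
    taxiLegV (gaugeV g U) x' (s.1, g x * s.2 * (g s.1)⁻¹) μ =
      ((taxiLegV U x' s μ).1, g x * (taxiLegV U x' s μ).2 * (g (taxiLegV U x' s μ).1)⁻¹) := by
  unfold taxiLegV
  split_ifs with h
  · simp only [parFwdV_gaugeV, mul_assoc, inv_mul_cancel_left]
  · simp only [parBwdV_gaugeV, mul_assoc, inv_mul_cancel_left]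

/-- a run of legs transports covariantly. [cite: Balaban1985BackgroundPropagators, (3.28) p.395, (3.40) p.397] -/
theorem taxiRun_gaugeV (g : Site P 0 → 𝔹ˣ) (U : CfgV1 P 𝔹) (x' : Site P 0) :
    ∀ (l : List (Fin P.d)) (x : Site P 0) (s : Site P 0 × 𝔹ˣ),
      taxiRun (gaugeV g U) x' l (s.1, g x * s.2 * (g s.1)⁻¹) =
        ((taxiRun U x' l s).1, g x * (taxiRun U x' l s).2 * (g (taxiRun U x' l s).1)⁻¹)
  | [], x, s => rfl
  | μ :: l, x, s => by
    simp only [taxiRun, List.foldl_cons]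
    have h := taxiRun_gaugeV g U x' l x (taxiLegV U x' s μ)
    simp only [taxiRun] at h
    rw [taxiLegV_gaugeV, h]

/-- ★ **THE TAXICAB TRANSPORTER TRANSFORMS AS A CONTOUR VARIABLE**: `U^u(Γ_{x,x′}) = u(x)U(Γ_{x,x′})u(x′)⁻¹`.
[cite: Balaban1985BackgroundPropagators, (3.28) p.395, (3.40) p.397] -/
theorem parTaxiV_gaugeV (g : Site P 0 → 𝔹ˣ) (U : CfgV1 P 𝔹) (x x' : Site P 0) :
    parTaxiV (gaugeV g U) x x' = g x * parTaxiV U x x' * (g x')⁻¹ := by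
  have h := taxiRun_gaugeV g U x' (List.finRange P.d) x (x, 1)
  have hend : (taxiRun U x' (List.finRange P.d) (x, 1)).1 = x' := taxiEnd_eq U x x'
  simp only [mul_one, mul_inv_cancel, hend] at h
  unfold parTaxiV
  rw [h]

end Torus

/-! ## §4 NODE 00's carriers: the gauge function read on sites, bonds, plaquettes, blocks, coarse bonds; the laws of the transporter tables -/

section Tables

variable (i : KIdx d ℓ hd hL b₀ b₁)

/-- the gauge functions `u : T_η → G` at an index (`𝔸ˣ`-valued; the subgroup is immaterial for the algebra). [cite: Balaban1985BackgroundPropagators, (3.28) p.395] -/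
abbrev GaugeY (𝔸 : Type) [NormedRing 𝔸] [NormedAlgebra ℂ 𝔸] [CompleteSpace 𝔸] (i : KIdx d ℓ hd hL b₀ b₁) : Type :=
  Site (PV d ℓ i.m i.K hd hL) 0 → 𝔸ˣ

/-- ★ (3.28) on NODE 00's backgrounds: `U^u = gaugeV u U`. [cite: Balaban1985BackgroundPropagators, (3.28) p.395] -/
def gaugeY (g : GaugeY 𝔸 i) (U : CfgY 𝔸 i) : CfgY 𝔸 i := gaugeV g U

/-- (3.28), unfolded. [cite: Balaban1985BackgroundPropagators, (3.28) p.395] -/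
theorem gaugeY_apply (g : GaugeY 𝔸 i) (U : CfgY 𝔸 i) (μ : Fin (d + 1)) (x : Site (PV d ℓ i.m i.K hd hL) 0) :
    gaugeY i g U μ x = g x * U μ x * (g (x.shift μ))⁻¹ := rfl

/-- `u` read on the SITE carrier (box chart). [cite: Balaban1985BackgroundPropagators, (3.28) p.395, dictionary] -/
def gSiteY (g : GaugeY 𝔸 i) : SiteY i → 𝔸ˣ := fun z => g ((boxEquiv i.hN).symm z)

/-- `u` read on the BOND carrier: at the initial point `b₋` («(R(u)U′)(x, x′) = R(u(x))U′(x, x′)»). [cite: Balaban1985BackgroundPropagators, (3.28) p.395] -/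
def gBondY (g : GaugeY 𝔸 i) : FBondY i → 𝔸ˣ := fun b => g b.src

/-- `u` read on the PLAQUETTE carrier: at the corner `x` of `p = ⟨x, x+e_μ, x+e_μ+e_ν, x+e_ν⟩`. [cite: Balaban1985BackgroundPropagators, (3.2) p.390, (3.28) p.395] -/
def gPlaqY (g : GaugeY 𝔸 i) : PlaqY i → 𝔸ˣ := fun p => g p.src

/-- `u` read on the BLOCK carrier: at the block's reference corner. [cite: Balaban1985BackgroundPropagators, (3.21) p.394, (3.28) p.395, dictionary] -/
def gBlkY (g : GaugeY 𝔸 i) : BlkY i → 𝔸ˣ := fun s => gSiteY i g (blkCornerY i s)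

/-- `u` read on the COARSE-BOND carrier: at the initial point of the coarse bond. [cite: Balaban1985BackgroundPropagators, (3.12) p.392, (3.28) p.395, dictionary] -/
def gIBondY (g : GaugeY 𝔸 i) : IBondY i → 𝔸ˣ := fun ι => g (embIter (ι.1.1 : ℕ) ι.1.2.src)

/-- a non-zero gradient entry `∂(b, z)` forces `z ∈ {b₊, b₋}` (chart reading of r03's stencil). [cite: Balaban1984PropagatorsI, (1.2) p.18, dictionary] -/
theorem gradK_ne_zero_cases {b : FBondY i} {z : SiteY i} (h : gradK i b z ≠ 0) : z = boxEquiv i.hN b.tgt ∨ z = boxEquiv i.hN b.src := by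
  have h' : LinearMap.toMatrix' (onFun (dE (P := PV d ℓ i.m i.K hd hL) i.cf)) b ((boxEquiv i.hN).symm z) ≠ 0 := h
  rcases dE_ne_zero_cases h' with h1 | h1
  · exact Or.inl ((Equiv.symm_apply_eq _).1 h1.symm)
  · exact Or.inr ((Equiv.symm_apply_eq _).1 h1.symm)

/-- ★ the GRADIENT TRANSPORTERS transform as `T′(b, z) = u(b₋)T(b, z)u(z)⁻¹` on the stencil. [cite: Balaban1985BackgroundPropagators, (3.3) p.390, (3.28) p.395] -/
theorem gradT_gaugeY (g : GaugeY 𝔸 i) (U : CfgY 𝔸 i) {b : FBondY i} {z : SiteY i} (h : gradK i b z ≠ 0) :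
    gradT i (gaugeY i g U) b z = gBondY i g b * gradT i U b z * (gSiteY i g z)⁻¹ := by
  unfold gradT
  by_cases hz : z = boxEquiv i.hN b.tgt
  · rw [if_pos hz, if_pos hz]
    simp only [gaugeY_apply, gBondY, gSiteY, hz, Equiv.symm_apply_apply]
    rfl
  · rw [if_neg hz, if_neg hz]
    rcases gradK_ne_zero_cases i h with h1 | h1
    · exact absurd h1 hz
    · simp only [gBondY, gSiteY, h1, Equiv.symm_apply_apply, mul_one, mul_inv_cancel]

/-- ★ the CURL TRANSPORTERS transform as `T′(p, b) = u(x)T(p, b)u(b₋)⁻¹` on the stencil (`x` the corner of `p`). [cite: Balaban1985BackgroundPropagators, (3.4) p.391, (3.28) p.395] -/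
theorem curlT_gaugeY (g : GaugeY 𝔸 i) (U : CfgY 𝔸 i) {p : PlaqY i} {b : FBondY i} (h : curlK i p b ≠ 0) :
    curlT i (gaugeY i g U) p b = gPlaqY i g p * curlT i U p b * (gBondY i g b)⁻¹ := by
  unfold curlT
  by_cases h1 : b = ⟨p.src.shift p.μ, p.ν⟩
  · rw [if_pos h1, if_pos h1, h1]
    rfl
  · rw [if_neg h1, if_neg h1]
    by_cases h2 : b = ⟨p.src.shift p.ν, p.μ⟩
    · rw [if_pos h2, if_pos h2, h2]
      rfl
    · rw [if_neg h2, if_neg h2]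
      have h' : LinearMap.toMatrix' (onFun (dcE (P := PV d ℓ i.m i.K hd hL) i.cf)) p b ≠ 0 := h
      have hb : b.src = p.src := by
        rcases dcE_ne_zero_cases h' with e | e | e | e
        · rw [← e]
        · exact absurd e.symm h1
        · exact absurd e.symm h2
        · rw [← e]
      simp only [gPlaqY, gBondY, hb, mul_one, mul_inv_cancel]

/-- a CONTOUR TRANSPORTER of the bond sector transforms as a contour variable: `U^u(Γ_{y,x}) = u(y)U(Γ_{y,x})u(x)⁻¹`.
[cite: Balaban1985BackgroundPropagators, (3.28) p.395, (3.40) p.397] -/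
def IsGaugeLawB (parB : BondParY 𝔸 i) : Prop :=
  ∀ (g : GaugeY 𝔸 i) (U : CfgY 𝔸 i) (y x : Site (PV d ℓ i.m i.K hd hL) 0), parB (gaugeY i g U) y x = g y * parB U y x * (g x)⁻¹

/-- a CONTOUR TRANSPORTER of the site sector (box chart) transforms as a contour variable. [cite: Balaban1985BackgroundPropagators, (3.28) p.395, (3.40) p.397] -/
def IsGaugeLawS (parS : SiteParY 𝔸 i) : Prop :=
  ∀ (g : GaugeY 𝔸 i) (U : CfgY 𝔸 i) (z z' : SiteY i), parS (gaugeY i g U) z z' = gSiteY i g z * parS U z z' * (gSiteY i g z')⁻¹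

/-- ★ def-Y's TAXICAB bond transporter `parBY` obeys the law. [cite: Balaban1985BackgroundPropagators, (3.28) p.395, (3.40) p.397] -/
theorem parBY_isGaugeLawB : IsGaugeLawB i (parBY (𝔸 := 𝔸) i) := fun g U y x => parTaxiV_gaugeV g U y x

/-- ★ def-Y's TAXICAB site transporter `parSY` obeys the law. [cite: Balaban1985BackgroundPropagators, (3.28) p.395, (3.40) p.397] -/
theorem parSY_isGaugeLawS : IsGaugeLawS i (parSY (𝔸 := 𝔸) i) := fun g U _ _ => parTaxiV_gaugeV g U _ _

variable {i} in
/-- the averaging transporters `Q(U)` transform as `T′(ι, b) = u(y_ι)T(ι, b)u(b₋)⁻¹` (everywhere). [cite: Balaban1985BackgroundPropagators, (3.12)–(3.14) pp.392–393, (3.32) pp.395–396] -/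
theorem qT_gaugeY {parB : BondParY 𝔸 i} (hB : IsGaugeLawB i parB) (g : GaugeY 𝔸 i) (U : CfgY 𝔸 i) (ι : IBondY i) (b : FBondY i) :
    qT i parB (gaugeY i g U) ι b = gIBondY i g ι * qT i parB U ι b * (gBondY i g b)⁻¹ := hB g U _ _

variable {i} in
/-- the block-averaging transporters `Q′(U)` transform as `T′(s, z) = u(c_s)T(s, z)u(z)⁻¹` (everywhere). [cite: Balaban1985BackgroundPropagators, (3.19) p.393, (3.32) p.395] -/
theorem qpT_gaugeY {parS : SiteParY 𝔸 i} (hS : IsGaugeLawS i parS) (g : GaugeY 𝔸 i) (U : CfgY 𝔸 i) (s : BlkY i) (z : SiteY i) :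
    qpT i parS (gaugeY i g U) s z = gBlkY i g s * qpT i parS U s z * (gSiteY i g z)⁻¹ := hS g U _ _

end Tables

/-! ## §5 (3.30)–(3.32) for the derivative and averaging letters: `L(U^u) ∘ R(u) = R(u) ∘ L(U)` -/

section Letters

variable (i : KIdx d ℓ hd hL b₀ b₁) (g : GaugeY 𝔸 i) (U : CfgY 𝔸 i)

/-- ★ **(3.31)′ for `D_U : sites → bonds`**: `D_{U^u}R(u) = R(u)D_U` (the first-order operator behind (3.31)). [cite: Balaban1985BackgroundPropagators, (3.3) p.390, (3.31) p.395] -/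
theorem gradY_cov : Intw (conjY (gSiteY i g)) (conjY (gBondY i g)) (gradY i U) (gradY i (gaugeY i g U)) :=
  intw_trLiftY _ _ _ _ _ fun _ _ h => gradT_gaugeY i g U h

/-- ★ (3.31)′ for `D*_U : bonds → sites`. [cite: Balaban1985BackgroundPropagators, (3.8) p.392, (3.31) p.395] -/
theorem divY_cov : Intw (conjY (gBondY i g)) (conjY (gSiteY i g)) (divY i U) (divY i (gaugeY i g U)) := by
  rw [divY_eq_transpose, divY_eq_transpose]
  exact intw_trLiftY_transpose _ _ _ _ _ fun _ _ h => gradT_gaugeY i g U h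

/-- ★ (3.30)′ for the curl `D_U : bonds → plaquettes`. [cite: Balaban1985BackgroundPropagators, (3.4) p.391, (3.30) p.395] -/
theorem curlY_cov : Intw (conjY (gBondY i g)) (conjY (gPlaqY i g)) (curlY i U) (curlY i (gaugeY i g U)) :=
  intw_trLiftY _ _ _ _ _ fun _ _ h => curlT_gaugeY i g U h

/-- ★ (3.30)′ for the co-curl `D*_U : plaquettes → bonds`. [cite: Balaban1985BackgroundPropagators, (3.9) p.392, (3.30) p.395] -/
theorem coCurlY_cov : Intw (conjY (gPlaqY i g)) (conjY (gBondY i g)) (coCurlY i U) (coCurlY i (gaugeY i g U)) := by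
  rw [coCurlY_eq_transpose, coCurlY_eq_transpose]
  exact intw_trLiftY_transpose _ _ _ _ _ fun _ _ h => curlT_gaugeY i g U h

variable {i} in
/-- ★ (3.32) for `Q(U) : bonds → coarse bonds`, for any contour transporter obeying the law. [cite: Balaban1985BackgroundPropagators, (3.12)–(3.14) pp.392–393, (3.32) pp.395–396 («the equalities (3.32) hold again»)] -/
theorem QY_cov {parB : BondParY 𝔸 i} (hB : IsGaugeLawB i parB) :
    Intw (conjY (gBondY i g)) (conjY (gIBondY i g)) (QY i parB U) (QY i parB (gaugeY i g U)) :=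
  intw_trLiftY _ _ _ _ _ fun ι b _ => qT_gaugeY hB g U ι b

variable {i} in
/-- ★ (3.32) for `Q*(U) : coarse bonds → bonds`. [cite: Balaban1985BackgroundPropagators, (3.13) p.393, (3.32) pp.395–396] -/
theorem QsY_cov {parB : BondParY 𝔸 i} (hB : IsGaugeLawB i parB) :
    Intw (conjY (gIBondY i g)) (conjY (gBondY i g)) (QsY i parB U) (QsY i parB (gaugeY i g U)) := by
  rw [QsY_eq_transpose, QsY_eq_transpose]
  exact intw_trLiftY_transpose _ _ _ _ _ fun ι b _ => qT_gaugeY hB g U ι b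

variable {i} in
/-- ★ **(3.32) for `Q′(U) : sites → blocks`**: `Q′(U^u)R(u)λ = R(u)Q′(U)λ`. [cite: Balaban1985BackgroundPropagators, (3.19) p.393, (3.32) p.395] -/
theorem QpY_cov {parS : SiteParY 𝔸 i} (hS : IsGaugeLawS i parS) :
    Intw (conjY (gSiteY i g)) (conjY (gBlkY i g)) (QpY i parS U) (QpY i parS (gaugeY i g U)) :=
  intw_trLiftY _ _ _ _ _ fun s z _ => qpT_gaugeY hS g U s z

variable {i} in
/-- ★ (3.32) for `Q′*(U) : blocks → sites` (law everywhere, so no transpose is needed). [cite: Balaban1985BackgroundPropagators, (3.24)–(3.25) p.394, (3.32) p.395] -/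
theorem QpsY_cov {parS : SiteParY 𝔸 i} (hS : IsGaugeLawS i parS) :
    Intw (conjY (gBlkY i g)) (conjY (gSiteY i g)) (QpsY i parS U) (QpsY i parS (gaugeY i g U)) :=
  intw_trLiftY _ _ _ _ _ fun z s _ => by rw [qpT_gaugeY hS, mul_inv_rev, mul_inv_rev, inv_inv, mul_assoc]

/-- the weight matrix `a` is diagonal: `a(ι, ι′) = w_ι [ι = ι′]`. [cite: Balaban1984PropagatorsII, (2.18)–(2.20) p.226 («a multiplication operator»), dictionary] -/
theorem aK_eq_diagonal : aK i = Matrix.diagonal i.w := by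
  ext ι ι'
  rw [aK, LinearMap.toMatrix'_apply, onFun_apply, aE_apply, Matrix.diagonal_apply, WithLp.ofLp_toLp, Pi.single_apply]
  split_ifs <;> simp

/-- (3.34)′ for the weight `a` (no transport: a real diagonal weight commutes with `R(u)`). [cite: Balaban1985BackgroundPropagators, (3.26) p.395, (3.34) p.396] -/
theorem aY_cov : Intw (conjY (gIBondY i g)) (conjY (gIBondY i g)) (aY (𝔸 := 𝔸) i) (aY i) := by
  rw [aY, aK_eq_diagonal]
  exact intw_liftMatY_diagonal _ _

/-! ### The holonomy, the Jordan insertion and the curvature operator `Δ′₂` -/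

/-- ★ **THE PLAQUETTE HOLONOMY IS CONJUGATED AT THE CORNER**: `U^u(∂p) = u(x)U(∂p)u(x)⁻¹`. [cite: Balaban1985BackgroundPropagators, (3.1) p.390, (3.28) p.395] -/
theorem holY_gaugeY (p : PlaqY i) : holY i (gaugeY i g U) p = g p.src * holY i U p * (g p.src)⁻¹ := by
  simp only [holY, gaugeY_apply, shift_shift_comm' p.src p.ν p.μ, mul_inv_rev, inv_inv, mul_assoc, inv_mul_cancel_left]

/-- `Re U^u(∂p) = R(u(x)) Re U(∂p)`. [cite: Balaban1985BackgroundPropagators, (3.7) p.392, (3.28) p.395] -/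
theorem reHolY_gaugeY (p : PlaqY i) : reHolY i (gaugeY i g U) p = R (g p.src) (reHolY i U p) := by
  rw [reHolY, reHolY, holY_gaugeY, show (g p.src * holY i U p * (g p.src)⁻¹)⁻¹ = g p.src * (holY i U p)⁻¹ * (g p.src)⁻¹ by
    rw [mul_inv_rev, mul_inv_rev, inv_inv, mul_assoc], val_conj_eq_R, val_conj_eq_R, ← R_add, ← R_smul]

/-- `Im U^u(∂p) = R(u(x)) Im U(∂p)`. [cite: Balaban1985BackgroundPropagators, (3.7) p.392, (3.28) p.395] -/
theorem imHolY_gaugeY (p : PlaqY i) : imHolY i (gaugeY i g U) p = R (g p.src) (imHolY i U p) := by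
  rw [imHolY, imHolY, holY_gaugeY, show (g p.src * holY i U p * (g p.src)⁻¹)⁻¹ = g p.src * (holY i U p)⁻¹ * (g p.src)⁻¹ by
    rw [mul_inv_rev, mul_inv_rev, inv_inv, mul_assoc], val_conj_eq_R, val_conj_eq_R, ← R_sub, ← R_smul]

/-- the Jordan insertion, evaluated. [cite: Balaban1985BackgroundPropagators, (3.7) p.392, (3.10) p.392, bookkeeping] -/
theorem jordanY_apply (F : PlaqY i → 𝔸) (p : PlaqY i) : jordanY i U F p = (1 / 2 : ℂ) • (F p * reHolY i U p + reHolY i U p * F p) := rfl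

/-- ★ (3.30)′ for the Jordan insertion `𝒦_U`. [cite: Balaban1985BackgroundPropagators, (3.7) p.392, (3.10) p.392, (3.30) p.395] -/
theorem jordanY_cov : Intw (conjY (gPlaqY i g)) (conjY (gPlaqY i g)) (jordanY i U) (jordanY i (gaugeY i g U)) := by
  refine LinearMap.ext fun F => funext fun p => ?_
  show jordanY i (gaugeY i g U) (conjY (gPlaqY i g) F) p = R (gPlaqY i g p) (jordanY i U F p)
  rw [jordanY_apply, jordanY_apply, conjY_apply, reHolY_gaugeY, R_smul, R_add, ← R_mul_R, ← R_mul_R]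
  rfl

/-- the transporters of the primed contour variables transform as `V′_m = u(x)V_m u((b_m)₋)⁻¹`. [cite: Balaban1985BackgroundPropagators, (3.2) p.390, (3.28) p.395] -/
theorem edgeParY_gaugeY (p : PlaqY i) (m : Fin 4) :
    edgeParY i (gaugeY i g U) p m = g p.src * edgeParY i U p m * (g (edgeY i p m).src)⁻¹ := by
  fin_cases m <;> simp [edgeParY, edgeY, gaugeY_apply]

/-- the primed contour variables are conjugated at the corner: `A′(b_m)[U^u, R(u)A] = R(u(x))A′(b_m)[U, A]`. [cite: Balaban1985BackgroundPropagators, (3.2) p.390, (3.30) p.395] -/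
theorem primeEdgeY_cov (p : PlaqY i) (m : Fin 4) :
    Intw (conjY (gBondY i g)) (RL (g p.src)) (primeEdgeY i U p m) (primeEdgeY i (gaugeY i g U) p m) := by
  unfold primeEdgeY
  refine Intw.smul _ (Intw.comp (intw_RL ?_) (intw_proj (gBondY i g) (edgeY i p m)))
  rw [edgeParY_gaugeY, gBondY, inv_mul_cancel_right]

/-- ★ **(3.30) FOR THE CURVATURE OPERATOR `Δ′₂`**: `Δ′₂(U^u)R(u) = R(u)Δ′₂(U)`. [cite: Balaban1985BackgroundPropagators, (3.10) p.392, (3.30) p.395] -/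
theorem curv2Y_cov : Intw (conjY (gBondY i g)) (conjY (gBondY i g)) (curv2Y i U) (curv2Y i (gaugeY i g U)) := by
  unfold curv2Y
  refine Intw.smul _ (intw_pi (gBondY i g) fun b => Intw.sum _ fun p _ => Intw.sum _ fun m _ => Intw.ite _ fun hb => ?_)
  have hS : Intw (conjY (gBondY i g)) (RL (g p.src))
      ((∑ l, if m < l then primeEdgeY i U p l else 0) - ∑ l, if l < m then primeEdgeY i U p l else 0)
      ((∑ l, if m < l then primeEdgeY i (gaugeY i g U) p l else 0) - ∑ l, if l < m then primeEdgeY i (gaugeY i g U) p l else 0) :=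
    Intw.sub (Intw.sum _ fun l _ => Intw.ite _ fun _ => primeEdgeY_cov i g U p l)
      (Intw.sum _ fun l _ => Intw.ite _ fun _ => primeEdgeY_cov i g U p l)
  have hC : Intw (RL (g p.src)) (RL (g p.src)) (commY ((((i.cf ^ 2 : ℝ)) : ℂ) • imHolY i U p))
      (commY ((((i.cf ^ 2 : ℝ)) : ℂ) • imHolY i (gaugeY i g U) p)) := by
    rw [imHolY_gaugeY, ← R_smul]
    exact intw_commY _ _
  have hR : Intw (RL (g p.src)) (RL (gBondY i g b)) (RL (edgeParY i U p m)⁻¹) (RL (edgeParY i (gaugeY i g U) p m)⁻¹) := by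
    refine intw_RL ?_
    simp only [edgeParY_gaugeY, gBondY, ← hb, mul_inv_rev, inv_inv, mul_assoc, inv_mul_cancel, mul_one]
  exact Intw.smul _ (hR.comp (hC.comp hS))

/-- ★★ **(3.30) FOR THE HESSIAN `Δ(U) = D*_U 𝒦_U D_U + Δ′₂(U)` OF (3.10)**: `Δ(U^u)R(u) = R(u)Δ(U)`. [cite: Balaban1985BackgroundPropagators, (3.10) p.392, (3.30) p.395 («Δ(U^u) = R(u)Δ(U)R(u⁻¹)»)] -/
theorem hessY_cov : Intw (conjY (gBondY i g)) (conjY (gBondY i g)) (hessY i U) (hessY i (gaugeY i g U)) :=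
  (((coCurlY_cov i g U).comp (jordanY_cov i g U)).comp (curlY_cov i g U)).add (curv2Y_cov i g U)

end Letters

/-! ## §6 (3.31) for the site sector: `Δ_U`, the averaging term, `Δ′_a(U)` and `G′(U) = Δ′_a(U)⁻¹` -/

section SiteSector

variable (i : KIdx d ℓ hd hL b₀ b₁) (g : GaugeY 𝔸 i) (U : CfgY 𝔸 i)

/-- the box-chart shift is the torus shift read through the chart: `boxEquiv⁻¹(z + e_μ) = boxEquiv⁻¹(z) + e_μ`. [cite: Balaban1984PropagatorsII, (2.1) p.224, dictionary] -/
theorem boxEquiv_symm_shiftY (μ : Fin (d + 1)) (z : SiteY i) :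
    (boxEquiv i.hN).symm (shiftY i μ z) = ((boxEquiv i.hN).symm z).shift μ := by
  apply (boxEquiv i.hN).injective
  rw [Equiv.apply_symm_apply, boxEquiv_apply, toBox_shift, ← boxEquiv_apply, Equiv.apply_symm_apply]
  rfl

/-- (3.31)′ for `∇_{U,μ}` of the site sector, pointwise. [cite: Balaban1985BackgroundPropagators, (3.3) p.390, (3.31) p.395] -/
theorem cdS_gaugeY (μ : Fin (d + 1)) (Φ : SiteY i → 𝔸) (z : SiteY i) :
    cdS i (gaugeY i g U) μ (conjY (gSiteY i g) Φ) z = R (gSiteY i g z) (cdS i U μ Φ z) := by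
  simp only [cdS, B9Eq39Adjoint.covD, UboxY, conjY_apply, gSiteY, gaugeY_apply, boxEquiv_symm_shiftY, B9Eq39Adjoint.R_mul, R_inv_R,
    R_sub]

/-- (3.31)′ for `∇*_{U,μ}` of the site sector, pointwise. [cite: Balaban1985BackgroundPropagators, (3.8) p.392, (3.31) p.395] -/
theorem cdsS_gaugeY (μ : Fin (d + 1)) (Φ : SiteY i → 𝔸) (z : SiteY i) :
    cdsS i (gaugeY i g U) μ (conjY (gSiteY i g) Φ) z = R (gSiteY i g z) (cdsS i U μ Φ z) := by
  have hz : ((boxEquiv i.hN).symm ((shiftY i μ).symm z)).shift μ = (boxEquiv i.hN).symm z := by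
    rw [← boxEquiv_symm_shiftY, Equiv.apply_symm_apply]
  simp only [cdsS, B9Eq39Adjoint.covDstar, UboxY, conjY_apply, gSiteY, gaugeY_apply, hz, mul_inv_rev, inv_inv, B9Eq39Adjoint.R_mul,
    R_inv_R, R_sub]

/-- ★ **(3.31) FOR THE COVARIANT LAPLACIAN OF THE SITE SECTOR**: `Δ_{U^u}R(u) = R(u)Δ_U`. [cite: Balaban1985BackgroundPropagators, (3.23) p.394, (3.31) p.395 («Δ_{U^u} = R(u)Δ_U R(u⁻¹)»)] -/
theorem lapSL_cov : Intw (conjY (gSiteY i g)) (conjY (gSiteY i g)) (lapSL i U) (lapSL i (gaugeY i g U)) := by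
  refine LinearMap.ext fun Φ => funext fun z => ?_
  show lapS i (gaugeY i g U) (conjY (gSiteY i g) Φ) z = R (gSiteY i g z) (lapS i U Φ z)
  have h : ∀ μ, cdS i (gaugeY i g U) μ (conjY (gSiteY i g) Φ) = conjY (gSiteY i g) (cdS i U μ Φ) :=
    fun μ => funext fun w => cdS_gaugeY i g U μ Φ w
  simp only [lapS, h, cdsS_gaugeY]
  exact (map_sum (RL (gSiteY i g z)) _ _).symm

variable {i} in
/-- the averaging transporter through the block corner transforms as a contour variable. [cite: Balaban1985BackgroundPropagators, (3.19) p.393, (3.24) p.394, (3.28) p.395] -/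
theorem avgTrY_gaugeY {parS : SiteParY 𝔸 i} (hS : IsGaugeLawS i parS) (z w : SiteY i) :
    avgTrY i parS (gaugeY i g U) z w = gSiteY i g z * avgTrY i parS U z w * (gSiteY i g w)⁻¹ := by
  rw [avgTrY, avgTrY, hS, hS]
  simp only [mul_assoc, inv_mul_cancel_left]

variable {i} in
/-- ★ (3.31)–(3.32) for `Δ′_a(U)` (3.24). [cite: Balaban1985BackgroundPropagators, (3.24) p.394, (3.31)–(3.32) p.395] -/
theorem deltaPrimeAY_cov {parS : SiteParY 𝔸 i} (hS : IsGaugeLawS i parS) :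
    Intw (conjY (gSiteY i g)) (conjY (gSiteY i g)) (deltaPrimeAY i parS U) (deltaPrimeAY i parS (gaugeY i g U)) := by
  unfold deltaPrimeAY
  refine (lapSL_cov i g U).add ?_
  rw [kernelTrOpY_eq_trLiftY, kernelTrOpY_eq_trLiftY]
  exact intw_trLiftY _ _ _ _ _ fun z w _ => avgTrY_gaugeY g U hS z w

variable {i} in
/-- ★★ **(3.33) FOR `G′(U) = Δ′_a(U)⁻¹`**: `G′(U^u)R(u) = R(u)G′(U)` (where `Δ′_a(U)` is invertible the inverses are conjugate; elsewhere both
`Ring.inverse`s vanish). [cite: Balaban1985BackgroundPropagators, (3.33) p.396 («G′(U^u) = R(u)G′(U)R(u⁻¹)»)] -/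
theorem GpY_cov {parS : SiteParY 𝔸 i} (hS : IsGaugeLawS i parS) :
    Intw (conjY (gSiteY i g)) (conjY (gSiteY i g)) (GpY i parS U) (GpY i parS (gaugeY i g U)) :=
  (deltaPrimeAY_cov g U hS).ringInverse (isUnit_conjY _)

end SiteSector

/-! ## §7 (3.33)–(3.34) for `(Q′G′²Q′*)(U)`, its inverse, `R(U)` (3.25), `C(U)` (3.48), `Δ_a(U)` (3.26) and `G(U) = Δ_a(U)⁻¹` (3.27) -/

section BondSector

variable (i : KIdx d ℓ hd hL b₀ b₁) (g : GaugeY 𝔸 i) (U : CfgY 𝔸 i)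
variable {parS : SiteParY 𝔸 i} {parB : BondParY 𝔸 i} {Gp : SiteOpY 𝔸 i}

/-- `G′` is COVARIANT for the gauge function `u`: `G′(U^u)R(u) = R(u)G′(U)`. [cite: Balaban1985BackgroundPropagators, (3.33) p.396] -/
def IsCovSiteOpY (Gp : SiteOpY 𝔸 i) : Prop :=
  ∀ (g : GaugeY 𝔸 i) (U : CfgY 𝔸 i), Intw (conjY (gSiteY i g)) (conjY (gSiteY i g)) (Gp U) (Gp (gaugeY i g U))

variable {i} in
/-- def-Y's `G′(U)` is covariant (for a lawful site transporter). [cite: Balaban1985BackgroundPropagators, (3.33) p.396] -/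
theorem GpY_isCovSiteOpY (hS : IsGaugeLawS i parS) : IsCovSiteOpY i (GpY i parS) := fun g U => GpY_cov g U hS

variable {i g U}

/-- (3.33)′ for `(Q′G′²Q′*)(U)`. [cite: Balaban1985BackgroundPropagators, (3.25) p.394, (3.33) p.396] -/
theorem XY_cov (hS : IsGaugeLawS i parS) (hGp : IsCovSiteOpY i Gp) :
    Intw (conjY (gBlkY i g)) (conjY (gBlkY i g)) (XY i parS Gp U) (XY i parS Gp (gaugeY i g U)) :=
  (QpY_cov g U hS).comp ((hGp g U).comp ((hGp g U).comp (QpsY_cov g U hS)))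

/-- (3.33)′ for `(Q′G′²Q′*)⁻¹(U)`. [cite: Balaban1985BackgroundPropagators, (3.25) p.394, (3.33) p.396] -/
theorem XinvY_cov (hS : IsGaugeLawS i parS) (hGp : IsCovSiteOpY i Gp) :
    Intw (conjY (gBlkY i g)) (conjY (gBlkY i g)) (XinvY i parS Gp U) (XinvY i parS Gp (gaugeY i g U)) :=
  (XY_cov hS hGp).ringInverse (isUnit_conjY _)

/-- ★ **(3.33) for the PROJECTION `R(U)` of (3.25): `R(U^u)R(u) = R(u)R(U)`**. [cite: Balaban1985BackgroundPropagators, (3.25) p.394, (3.33) p.396 («R(U^u) = R(u)R(U)R(u⁻¹)»)] -/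
theorem RY_cov (hS : IsGaugeLawS i parS) (hGp : IsCovSiteOpY i Gp) :
    Intw (conjY (gSiteY i g)) (conjY (gSiteY i g)) (RY i parS Gp U) (RY i parS Gp (gaugeY i g U)) :=
  Intw.id.sub ((hGp g U).comp ((QpsY_cov g U hS).comp ((XinvY_cov hS hGp).comp ((QpY_cov g U hS).comp (hGp g U)))))

/-- ★ **(3.33)′ FOR THE LETTER `C(U)` (3.48)**: `C(U^u)R(u) = R(u)C(U)`. [cite: Balaban1985BackgroundPropagators, (3.48) p.398, (3.33) p.396] -/
theorem CY_cov (hS : IsGaugeLawS i parS) (hGp : IsCovSiteOpY i Gp) :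
    Intw (conjY (gBlkY i g)) (conjY (gBlkY i g)) (CY i parS Gp U) (CY i parS Gp (gaugeY i g U)) :=
  (XinvY_cov hS hGp).comp (intw_liftMatY_diagonal _ _)

/-- ★★ **(3.34) FOR `Δ_a(U)` (3.26)**: `Δ_a(U^u)R(u) = R(u)Δ_a(U)`. [cite: Balaban1985BackgroundPropagators, (3.26) p.395, (3.34) p.396 («Δ_a(U^u) = R(u)Δ_a(U)R(u⁻¹)»)] -/
theorem deltaAY_cov (hS : IsGaugeLawS i parS) (hB : IsGaugeLawB i parB) (hGp : IsCovSiteOpY i Gp) :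
    Intw (conjY (gBondY i g)) (conjY (gBondY i g)) (deltaAY i parS parB Gp U) (deltaAY i parS parB Gp (gaugeY i g U)) :=
  ((hessY_cov i g U).add ((gradY_cov i g U).comp ((RY_cov hS hGp).comp (divY_cov i g U)))).add
    ((QsY_cov g U hB).comp ((aY_cov i g).comp (QY_cov g U hB)))

/-- ★★★ **(3.34) FOR `G(U) = Δ_a(U)⁻¹` (3.27)**: `G(U^u)R(u) = R(u)G(U)`. [cite: Balaban1985BackgroundPropagators, (3.27) p.395, (3.34) p.396 («G(U^u) = R(u)G(U)R(u⁻¹)»)] -/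
theorem GAY_cov (hS : IsGaugeLawS i parS) (hB : IsGaugeLawB i parB) (hGp : IsCovSiteOpY i Gp) :
    Intw (conjY (gBondY i g)) (conjY (gBondY i g)) (GAY i parS parB Gp U) (GAY i parS parB Gp (gaugeY i g U)) :=
  (deltaAY_cov hS hB hGp).ringInverse (isUnit_conjY _)

end BondSector

/-! ## §8 The letters OF RECORD are gauge covariant -/

section Record

variable {x : MemberY d ℓ hd hL b₀ b₁ Mstar} (g : GaugeY 𝔸 x.toKIdx) (U : CfgY 𝔸 x.toKIdx)

variable (𝔸 x) in
/-- the site transporter of the v2 family obeys the law. [cite: Balaban1985BackgroundPropagators, (3.28) p.395, (3.40) p.397] -/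
theorem covLettersY_v2_parS_law : IsGaugeLawS x.toKIdx (covLettersY_v2 𝔸 x).parS := parSY_isGaugeLawS x.toKIdx

variable (𝔸 x) in
/-- the bond transporter of the v2 family obeys the law. [cite: Balaban1985BackgroundPropagators, (3.28) p.395, (3.40) p.397] -/
theorem covLettersY_v2_parB_law : IsGaugeLawB x.toKIdx (covLettersY_v2 𝔸 x).parB := parBY_isGaugeLawB x.toKIdx

/-- ★ the v2 family's `G′(U)` is covariant. [cite: Balaban1985BackgroundPropagators, (3.33) p.396] -/
theorem covLettersY_v2_Gp_cov :
    Intw (conjY (gSiteY x.toKIdx g)) (conjY (gSiteY x.toKIdx g)) ((covLettersY_v2 𝔸 x).Gp U) ((covLettersY_v2 𝔸 x).Gp (gaugeY x.toKIdx g U)) :=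
  GpY_cov g U (parSY_isGaugeLawS x.toKIdx)

/-- ★ the v2 family's `C(U)` is covariant. [cite: Balaban1985BackgroundPropagators, (3.33) p.396, (3.48) p.398] -/
theorem covLettersY_v2_C_cov :
    Intw (conjY (gBlkY x.toKIdx g)) (conjY (gBlkY x.toKIdx g)) ((covLettersY_v2 𝔸 x).C U) ((covLettersY_v2 𝔸 x).C (gaugeY x.toKIdx g U)) :=
  CY_cov (parSY_isGaugeLawS x.toKIdx) (GpY_isCovSiteOpY (parSY_isGaugeLawS x.toKIdx))

/-- ★★ the v2 family's `G(U)` is covariant: `G(U^u)R(u) = R(u)G(U)`. [cite: Balaban1985BackgroundPropagators, (3.34) p.396] -/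
theorem covLettersY_v2_GA_cov :
    Intw (conjY (gBondY x.toKIdx g)) (conjY (gBondY x.toKIdx g)) ((covLettersY_v2 𝔸 x).GA U) ((covLettersY_v2 𝔸 x).GA (gaugeY x.toKIdx g U)) :=
  GAY_cov (parSY_isGaugeLawS x.toKIdx) (parBY_isGaugeLawB x.toKIdx) (GpY_isCovSiteOpY (parSY_isGaugeLawS x.toKIdx))

open scoped Matrix.Norms.L2Operator in
/-- ★★★ **THE LETTERS OF RECORD ARE GAUGE COVARIANT** (3.33)–(3.34): for every member `x`, every gauge function `u` and every background `U`,
`G(U^u)R(u) = R(u)G(U)`, `C(U^u)R(u) = R(u)C(U)`, `G′(U^u)R(u) = R(u)G′(U)`, and the transporters transform as contour variables.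
[cite: Balaban1985BackgroundPropagators, (3.28) p.395, (3.33)–(3.34) p.396] -/
theorem lettersYOfRecord_cov (N : ℕ) (θ : Stage3Params) (Mstar : ℕ) (x : MemberY θ.d₆ θ.ℓ₆ θ.hd' θ.hL' θ.b₀ θ.b₁ Mstar)
    (g : GaugeY (Matrix (Fin N) (Fin N) ℂ) x.toKIdx) (U : CfgY (Matrix (Fin N) (Fin N) ℂ) x.toKIdx) :
    Intw (conjY (gBondY x.toKIdx g)) (conjY (gBondY x.toKIdx g)) ((lettersYOfRecord N θ Mstar x).GA U)
        ((lettersYOfRecord N θ Mstar x).GA (gaugeY x.toKIdx g U)) ∧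
      Intw (conjY (gBlkY x.toKIdx g)) (conjY (gBlkY x.toKIdx g)) ((lettersYOfRecord N θ Mstar x).C U)
        ((lettersYOfRecord N θ Mstar x).C (gaugeY x.toKIdx g U)) ∧
      Intw (conjY (gSiteY x.toKIdx g)) (conjY (gSiteY x.toKIdx g)) ((lettersYOfRecord N θ Mstar x).Gp U)
        ((lettersYOfRecord N θ Mstar x).Gp (gaugeY x.toKIdx g U)) ∧
      IsGaugeLawS x.toKIdx (lettersYOfRecord N θ Mstar x).parS ∧ IsGaugeLawB x.toKIdx (lettersYOfRecord N θ Mstar x).parB :=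
  ⟨covLettersY_v2_GA_cov g U, covLettersY_v2_C_cov g U, covLettersY_v2_Gp_cov g U, covLettersY_v2_parS_law _ x, covLettersY_v2_parB_law _ x⟩

end Record

end Literature.MathematicalPhysics.QuantumFieldTheory.Balaban1983to89.Node00
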